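import Literature.AlgebraicGeometry.Resolution.RegularLocalRingsJacobian
import Mathlib.RingTheory.DiscreteValuationRing.TFAE
import Mathlib.RingTheory.Polynomial.Eisenstein.Basic
import Mathlib.RingTheory.AdjoinRoot
import HarnessLib

/-!
# Local hinges of the idea cards 1 / 2 / 6 of `res-L1-w45b-idea-2` (crux `EquisingularLift`, honest variant
# EL♮ = `EquisingularLiftNat`, stmt-ResolutionOfSingularities-20038)

[OURS · L W4.5 (b)] Helper for the idea cards `unscrew-split-orbits` (card 1), `tuned-kummer-collapse` (card 2) and
`curvilinear-weights` (card 6) of `res-L1-w45b-idea-2` (`Cruxes/EquisingularLift/Ideas/`, Sketch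
`HOME/L/res-L1-w45b-idea-2/Sketch-L1-idea-2.lean` v5, decls `SplitOrbitInadmissible` l. 63, `SectionForcesGoodPoint`
l. 116, `CollapseSpeedOne` l. 129, `CollapseTraceIsRope` l. 138, `KummerBaseIsLocalPIR` l. 274). NOT statements of the
manuscript under review (Hironaka 2017); nothing here is attributed to its author. Pure commutative algebra; every
theorem named as in the Sketch has the Sketch's signature VERBATIM (triage: res-L1-w45b-tri-1 TRIAGE «`CollapseSpeedOne`
TRUE as typed (carries `2 ≤ e`)», res-L1-w45b-tri-2 TRIAGE §9.1 «`KummerBaseIsLocalPIR` TRUE»).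

Dress (Sketch header): `R` is the regular local ring of the running `O`-ambient at a closed point of the special fibre,
`ϖ ∈ 𝔪 ∖ 𝔪²` the image of a uniformizer of the base DVR; a SECTION IDEAL is a prime `𝔭` with `ϖ ∉ 𝔭` and
`𝔭 + (ϖ) = 𝔪`.

* `SectionForcesGoodPoint` (card 1 rev. 2 (d)) — `ϖ ∉ 𝔮`, `𝔮 + (ϖ) = 𝔪` ⟹ `ϖ ∉ 𝔪²` (Nakayama), any Noetherian local
  ring.
* `SplitOrbitInadmissible` (card 1 (a)) — two distinct section ideals `𝔭 ≠ 𝔮` ⟹ `R/(𝔭 ∩ 𝔮)` is not a regular local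
  ring: a regular local ring is a domain, so `𝔭 ∩ 𝔮` would be prime, i.e. `𝔭 ⊆ 𝔮` or `𝔮 ⊆ 𝔭`; but `R/𝔭` is a
  Noetherian local domain with principal maximal ideal `(ϖ̄)`, whose non-zero ideals are powers of `(ϖ̄)`
  (Mathlib `tfae_of_isNoetherianRing_of_isLocalRing_of_isDomain`), and `ϖ ∉ 𝔮` forbids `𝔮̄ = (ϖ̄ⁿ)`.
* `CollapseSpeedOne` (card 2 (a)) — `R/(yᵉ − ϖᵐ·u)` (`u` a unit, `e ≥ 2`, `m ≥ 1`) is regular iff `m = 1`: for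
  `e ≥ 2`, `yᵉ ∈ 𝔪²`, so the relator lies in `𝔪 ∖ 𝔪²` iff `m = 1` (tree: Matsumura 14.2 both ways,
  `IsRegularLocalRing.quotient_span_singleton` / `not_isRegularLocalRing_quotient_span_singleton_of_mem_sq`; the
  relator is non-zero because `ϖ` is prime and `y ∉ 𝔪² + (ϖ)`).
* `CollapseTraceIsRope` (card 2 (b)) — `(yᵉ − ϖu) + (ϖ) = (yᵉ) + (ϖ)`, any commutative ring.
* `KummerBaseIsLocalPIR` (card 6 (b)) — over a local principal ideal domain `O` with a prime `ϖ`, `O[X]/(Xᵉ − ϖ)`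
  (`e ≥ 1`) is a domain (Eisenstein at `(ϖ)`, Gauss), local (its maximal ideals contract to `(ϖ) = 𝔪_O` by
  integrality, hence contain `x̄` with `x̄ᵉ = ϖ`, hence equal the maximal ideal `(x̄)`, `O[X]/(Xᵉ − ϖ, X) = O/(ϖ)`
  being a field) and a principal ideal ring (Noetherian local domain with principal maximal ideal).

AI-written; AI review is weaker than expert review.
-/

set_option linter.dupNamespace false

noncomputable section

namespace Summit.ResolutionOfSingularities.ResolutionOfSingularities.Theorems.EquisingularLift.RamifiedCoalescence

open IsLocalRing Polynomial

/-! ## Card 1 rev. 2 (d): a section through a point forces good reduction there -/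

/-- **Card 1 rev. 2, step (d) (Sketch `SectionForcesGoodPoint`, VERBATIM).** In a Noetherian local ring `(R, 𝔪)`:
if `ϖ ∉ 𝔮` and `𝔮 + (ϖ) = 𝔪` then `ϖ ∉ 𝔪²`. Proof: otherwise `𝔪 = 𝔮 + (ϖ) ⊆ 𝔮 + 𝔪·𝔪`, so `𝔪 ⊆ 𝔮` by Nakayama,
whence `ϖ ∈ 𝔪 ⊆ 𝔮`. OURS. -/
theorem SectionForcesGoodPoint :
  ∀ (R : Type) [CommRing R] [IsLocalRing R] [IsNoetherianRing R] (ϖ : R) (𝔮 : Ideal R),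
    ϖ ∉ 𝔮 → 𝔮 ⊔ Ideal.span {ϖ} = maximalIdeal R → ϖ ∉ maximalIdeal R ^ 2 := by
  intro R _ _ _ ϖ 𝔮 hϖ𝔮 h𝔮 hϖ2
  have hϖm : ϖ ∈ maximalIdeal R := by
    rw [← h𝔮]; exact Ideal.mem_sup_right (Ideal.mem_span_singleton_self ϖ)
  have hle : maximalIdeal R ≤ 𝔮 ⊔ maximalIdeal R • maximalIdeal R := by
    conv_lhs => rw [← h𝔮]
    refine sup_le le_sup_left ?_
    rw [Ideal.span_singleton_le_iff_mem, Ideal.smul_eq_mul, ← pow_two]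
    exact Ideal.mem_sup_right hϖ2
  have key : maximalIdeal R ≤ 𝔮 :=
    Submodule.le_of_le_smul_of_le_jacobson_bot ((isNoetherian_def.mp inferInstance) _)
      (maximalIdeal_le_jacobson ⊥) hle
  exact hϖ𝔮 (key hϖm)

/-! ## Card 1 (a): a split orbit is never an admissible centre -/

/-- In a Noetherian local domain whose maximal ideal is generated by one element `π`, a prime ideal not
containing `π` is `⊥` (every non-zero ideal is a power of the maximal ideal). OURS (Mathlib
`tfae_of_isNoetherianRing_of_isLocalRing_of_isDomain`, (5) ⇒ (7)). -/
theorem eq_bot_of_isPrime_of_not_mem {D : Type*} [CommRing D] [IsDomain D] [IsLocalRing D] [IsNoetherianRing D]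
    {π : D} (hπ : maximalIdeal D = Ideal.span {π}) {Q : Ideal D} [Q.IsPrime] (hπQ : π ∉ Q) : Q = ⊥ := by
  by_contra hQ
  have hprinc : (maximalIdeal D).IsPrincipal := ⟨⟨π, by rw [hπ]⟩⟩
  have h7 := ((tfae_of_isNoetherianRing_of_isLocalRing_of_isDomain D).out 4 6).mp hprinc
  obtain ⟨n, hn⟩ := h7 Q hQ
  have : π ^ n ∈ Q := by
    rw [hn, hπ]
    exact Ideal.pow_mem_pow (Ideal.mem_span_singleton_self π) n
  exact hπQ (Ideal.IsPrime.mem_of_pow_mem inferInstance n this)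

/-- Two section ideals are incomparable: if `𝔭 ⊆ 𝔮` are primes with `ϖ ∉ 𝔮` and `𝔭 + (ϖ) = 𝔪` in a Noetherian
local ring, then `𝔭 = 𝔮` (in `R/𝔭` the maximal ideal is `(ϖ̄)` and `𝔮/𝔭` is a prime avoiding `ϖ̄`). OURS. -/
theorem eq_of_le_of_section {R : Type*} [CommRing R] [IsLocalRing R] [IsNoetherianRing R] (ϖ : R)
    {𝔭 𝔮 : Ideal R} [𝔭.IsPrime] [𝔮.IsPrime] (hle : 𝔭 ≤ 𝔮) (hϖ𝔮 : ϖ ∉ 𝔮)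
    (h𝔭 : 𝔭 ⊔ Ideal.span {ϖ} = maximalIdeal R) : 𝔭 = 𝔮 := by
  haveI : Nontrivial (R ⧸ 𝔭) := Ideal.Quotient.nontrivial_iff.mpr (Ideal.IsPrime.ne_top inferInstance)
  haveI : IsLocalRing (R ⧸ 𝔭) := .of_surjective' (Ideal.Quotient.mk 𝔭) Ideal.Quotient.mk_surjective
  -- the maximal ideal of `R/𝔭` is generated by the image of `ϖ`
  have hmax : maximalIdeal (R ⧸ 𝔭) = Ideal.span {Ideal.Quotient.mk 𝔭 ϖ} := by
    rw [Literature.AlgebraicGeometry.Resolution.maximalIdeal_quotient_eq_map 𝔭, ← h𝔭, Ideal.map_sup,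
      Ideal.map_span, Set.image_singleton]
    have : Ideal.map (Ideal.Quotient.mk 𝔭) 𝔭 = ⊥ := by
      rw [Ideal.map_eq_bot_iff_le_ker, Ideal.mk_ker]
    rw [this, bot_sup_eq]
  -- the image of `𝔮` is a prime avoiding `ϖ̄`, hence `⊥`
  haveI hQ : (𝔮.map (Ideal.Quotient.mk 𝔭)).IsPrime := Ideal.isPrime_map_quotientMk_of_isPrime hle
  have hϖQ : Ideal.Quotient.mk 𝔭 ϖ ∉ 𝔮.map (Ideal.Quotient.mk 𝔭) := by
    intro h
    rw [Ideal.mem_map_iff_of_surjective _ Ideal.Quotient.mk_surjective] at h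
    obtain ⟨q, hq, hqe⟩ := h
    rw [Ideal.Quotient.eq, ← Ideal.neg_mem_iff, neg_sub] at hqe
    have : ϖ - q + q ∈ 𝔮 := 𝔮.add_mem (hle hqe) hq
    simp only [sub_add_cancel] at this
    exact hϖ𝔮 this
  have hbot := eq_bot_of_isPrime_of_not_mem hmax hϖQ
  rw [Ideal.map_eq_bot_iff_le_ker, Ideal.mk_ker] at hbot
  exact le_antisymm hle hbot

/-- **Card 1, step (a) (Sketch `SplitOrbitInadmissible`, VERBATIM).** Over a base where two conjugate characteristic-0
point-centres are both rational (section ideals `𝔭 ≠ 𝔮` through the same closed point), their union `V(𝔭 ∩ 𝔮)` is not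
regular: a regular local ring is a domain (Matsumura 14.3), so `𝔭 ∩ 𝔮` would be prime, i.e. `𝔭 ⊆ 𝔮` or `𝔮 ⊆ 𝔭`, and
section ideals are pairwise incomparable (`eq_of_le_of_section`). OURS. -/
theorem SplitOrbitInadmissible :
  ∀ (R : Type) [CommRing R] [IsRegularLocalRing R] (ϖ : R) (𝔭 𝔮 : Ideal R), 𝔭.IsPrime → 𝔮.IsPrime → 𝔭 ≠ 𝔮 →
    ϖ ∉ 𝔭 → ϖ ∉ 𝔮 → 𝔭 ⊔ Ideal.span {ϖ} = maximalIdeal R → 𝔮 ⊔ Ideal.span {ϖ} = maximalIdeal R →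
    ¬ IsRegularLocalRing (R ⧸ (𝔭 ⊓ 𝔮)) := by
  intro R _ _ ϖ 𝔭 𝔮 h𝔭 h𝔮 hne hϖ𝔭 hϖ𝔮 h𝔭m h𝔮m hreg
  haveI := h𝔭
  haveI := h𝔮
  haveI := Literature.AlgebraicGeometry.Resolution.isDomain_of_isRegularLocalRing (R ⧸ (𝔭 ⊓ 𝔮))
  have hprime : (𝔭 ⊓ 𝔮).IsPrime := (Ideal.Quotient.isDomain_iff_prime _).mp ‹_›
  rcases hprime.inf_le.mp le_rfl with h | h
  · exact hne (eq_of_le_of_section ϖ (h.trans inf_le_right) hϖ𝔮 h𝔭m)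
  · exact hne (eq_of_le_of_section ϖ (h.trans inf_le_left) hϖ𝔭 h𝔮m).symm

/-! ## Card 2: irreducibly collapsing (Kummer) centres -/

/-- **Card 2, step (a) (Sketch `CollapseSpeedOne`, VERBATIM).** In a regular local ring with `ϖ ∈ 𝔪 ∖ 𝔪²` and a
parameter `y ∉ 𝔪² + (ϖ)`, the Kummer-collapsing hypersurface `yᵉ = ϖᵐ · u` (`u` a unit, `e ≥ 2`, `m ≥ 1`) is regular
IFF the collapse speed `ϖᵐ` is a uniformizer (`m = 1`): since `e ≥ 2`, `yᵉ ∈ 𝔪²`, so the relator `yᵉ − ϖᵐu ∈ 𝔪` lies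
outside `𝔪²` iff `ϖᵐu ∉ 𝔪²` iff `m = 1`; a quotient of a regular local ring by a non-zero `x ∈ 𝔪` is regular iff
`x ∉ 𝔪²` (Matsumura 14.2, tree `IsRegularLocalRing.quotient_span_singleton` and
`not_isRegularLocalRing_quotient_span_singleton_of_mem_sq`); the relator is non-zero because `ϖ` is prime
(`IsRegularLocalRing.prime_of_not_mem_sq`) and `y ∉ (ϖ) + 𝔪²`. OURS. -/
theorem CollapseSpeedOne :
  ∀ (R : Type) [CommRing R] [IsRegularLocalRing R] (ϖ y u : R) (e m : ℕ), IsUnit u →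
    ϖ ∈ maximalIdeal R → ϖ ∉ maximalIdeal R ^ 2 → y ∈ maximalIdeal R → y ∉ maximalIdeal R ^ 2 ⊔ Ideal.span {ϖ} →
    2 ≤ e → 1 ≤ m → (IsRegularLocalRing (R ⧸ Ideal.span {y ^ e - ϖ ^ m * u}) ↔ m = 1) := by
  intro R _ _ ϖ y u e m hu hϖ hϖ2 hy hy2 he hm
  have hye : y ^ e ∈ maximalIdeal R ^ 2 := by
    have : y ^ e ∈ maximalIdeal R ^ e := Ideal.pow_mem_pow hy e
    exact Ideal.pow_le_pow_right he this
  -- the relator is non-zero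
  have hne : y ^ e - ϖ ^ m * u ≠ 0 := by
    intro h
    have hϖp : Prime ϖ := Literature.AlgebraicGeometry.Resolution.IsRegularLocalRing.prime_of_not_mem_sq hϖ hϖ2
    have hdvd : ϖ ∣ y ^ e := by
      rw [sub_eq_zero] at h
      rw [h]
      exact Dvd.dvd.mul_right (dvd_pow_self ϖ (by omega)) u
    have hdvd' : ϖ ∣ y := hϖp.dvd_of_dvd_pow hdvd
    apply hy2
    exact Ideal.mem_sup_right (Ideal.mem_span_singleton.mpr hdvd')
  constructor
  · intro hreg
    by_contra hm1
    have hm2 : 2 ≤ m := by omega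
    have hmem : y ^ e - ϖ ^ m * u ∈ maximalIdeal R ^ 2 := by
      refine Ideal.sub_mem _ hye (Ideal.mul_mem_right u _ ?_)
      exact Ideal.pow_le_pow_right hm2 (Ideal.pow_mem_pow hϖ m)
    exact Literature.AlgebraicGeometry.Resolution.not_isRegularLocalRing_quotient_span_singleton_of_mem_sq
      hne hmem hreg
  · rintro rfl
    have hmem : y ^ e - ϖ ^ 1 * u ∈ maximalIdeal R :=
      Ideal.sub_mem _ (Ideal.pow_le_self (by omega) hye) (Ideal.mul_mem_right u _ (by simpa using hϖ))
    have hnot : y ^ e - ϖ ^ 1 * u ∉ maximalIdeal R ^ 2 := by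
      intro h
      have h1 : ϖ ^ 1 * u ∈ maximalIdeal R ^ 2 := by
        have := Ideal.sub_mem _ hye h
        simpa using this
      obtain ⟨v, hv⟩ := hu
      apply hϖ2
      have : ϖ ^ 1 * u * ↑v⁻¹ ∈ maximalIdeal R ^ 2 := Ideal.mul_mem_right _ _ h1
      simpa [← hv, mul_assoc] using this
    exact (Literature.AlgebraicGeometry.Resolution.IsRegularLocalRing.quotient_span_singleton hmem hnot).1

/-- **Card 2, step (b) (Sketch `CollapseTraceIsRope`, VERBATIM).** The trace of a speed-one collapse is the curvilinear
`e`-structure on its reduction: `(yᵉ − ϖu) + (ϖ) = (yᵉ) + (ϖ)` in any commutative ring. OURS. -/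
theorem CollapseTraceIsRope :
  ∀ (R : Type) [CommRing R] (ϖ y u : R) (e : ℕ),
    Ideal.span {y ^ e - ϖ * u} ⊔ Ideal.span {ϖ} = Ideal.span {y ^ e} ⊔ Ideal.span {ϖ} := by
  intro R _ ϖ y u e
  apply le_antisymm
  · refine sup_le ?_ le_sup_right
    rw [Ideal.span_singleton_le_iff_mem, Ideal.mem_span_singleton_sup]
    exact ⟨1, -(ϖ * u), (Ideal.span {ϖ}).neg_mem (Ideal.mul_mem_right u _ (Ideal.mem_span_singleton_self ϖ)),
      by ring⟩
  · refine sup_le ?_ le_sup_right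
    rw [Ideal.span_singleton_le_iff_mem, Ideal.mem_span_singleton_sup]
    exact ⟨1, ϖ * u, Ideal.mul_mem_right u _ (Ideal.mem_span_singleton_self ϖ), by ring⟩

/-! ## Card 6 (b): the Kummer base `O[X]/(Xᵉ − ϖ)` -/

section Kummer

variable {O : Type*} [CommRing O]

/-- `Xᵉ − ϖ` is Eisenstein at `(ϖ)` when `ϖ` is a prime element and `e ≥ 1`. OURS. -/
theorem isEisensteinAt_X_pow_sub_C [IsDomain O] {ϖ : O} (hϖ : Prime ϖ) {e : ℕ} (he : 1 ≤ e) :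
    (X ^ e - C ϖ : O[X]).IsEisensteinAt (Ideal.span {ϖ}) := by
  have hmon : (X ^ e - C ϖ : O[X]).Monic := monic_X_pow_sub_C ϖ (by omega)
  have hdeg : (X ^ e - C ϖ : O[X]).natDegree = e := natDegree_X_pow_sub_C
  refine ⟨?_, ?_, ?_⟩
  · rw [hmon.leadingCoeff, Ideal.mem_span_singleton]
    exact fun h => hϖ.not_unit (isUnit_of_dvd_one h)
  · intro n hn
    rw [hdeg] at hn
    rw [coeff_sub, coeff_X_pow, coeff_C]
    by_cases h0 : n = 0
    · subst h0
      have : (0 : ℕ) ≠ e := by omega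
      simp [this]
    · have : n ≠ e := by omega
      simp [this, h0]
  · rw [coeff_sub, coeff_X_pow, coeff_C]
    have : (0 : ℕ) ≠ e := by omega
    simp only [this, if_false, if_true, zero_sub, Ideal.neg_mem_iff, Ideal.span_singleton_pow,
      Ideal.mem_span_singleton]
    intro h
    -- `ϖ² ∣ ϖ` forces `ϖ` to be a unit
    obtain ⟨c, hc⟩ := h
    apply hϖ.not_unit
    have h1 : ϖ * (ϖ * c) = ϖ * 1 := by rw [mul_one, ← mul_assoc, ← pow_two]; exact hc.symm
    have h2 : ϖ * c = 1 := mul_left_cancel₀ hϖ.ne_zero h1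
    exact IsUnit.of_mul_eq_one c h2

/-- `Xᵉ − ϖ` is a prime element of `O[X]` for a prime `ϖ` of a principal ideal domain `O` and `e ≥ 1`
(Eisenstein + Gauss: `O[X]` is a UFD). OURS. -/
theorem prime_X_pow_sub_C [IsDomain O] [IsPrincipalIdealRing O] {ϖ : O} (hϖ : Prime ϖ) {e : ℕ} (he : 1 ≤ e) :
    Prime (X ^ e - C ϖ : O[X]) := by
  have hmon : (X ^ e - C ϖ : O[X]).Monic := monic_X_pow_sub_C ϖ (by omega)
  have hirr : Irreducible (X ^ e - C ϖ : O[X]) :=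
    (isEisensteinAt_X_pow_sub_C hϖ he).irreducible
      ((Ideal.span_singleton_prime hϖ.ne_zero).mpr hϖ) hmon.isPrimitive
      (by rw [natDegree_X_pow_sub_C]; omega)
  exact hirr.prime

/-- In `O[X]/(f)`, every class is congruent to a scalar modulo the class `x̄` of `X`
(`p = (p div X)·X + p(0)`). OURS. -/
theorem exists_sub_algebraMap_mem_span_root (f : O[X]) (s : AdjoinRoot f) :
    ∃ a : O, s - algebraMap O (AdjoinRoot f) a ∈ Ideal.span {AdjoinRoot.root f} := by
  obtain ⟨p, rfl⟩ := AdjoinRoot.mk_surjective s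
  refine ⟨p.coeff 0, Ideal.mem_span_singleton.mpr ⟨AdjoinRoot.mk f p.divX, ?_⟩⟩
  have h := congrArg (AdjoinRoot.mk f) (Polynomial.divX_mul_X_add p)
  rw [map_add, map_mul, AdjoinRoot.mk_X, AdjoinRoot.mk_C] at h
  rw [← h, AdjoinRoot.algebraMap_eq]
  ring

/-- `x̄ᵉ = ϖ` in `O[X]/(Xᵉ − ϖ)`. OURS. -/
theorem root_X_pow_sub_C_pow (ϖ : O) (e : ℕ) :
    AdjoinRoot.root (X ^ e - C ϖ : O[X]) ^ e = algebraMap O (AdjoinRoot (X ^ e - C ϖ : O[X])) ϖ := by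
  have h0 := AdjoinRoot.aeval_eq (f := (X ^ e - C ϖ : O[X])) (X ^ e - C ϖ)
  rw [AdjoinRoot.mk_self, map_sub, map_pow, aeval_X, aeval_C, sub_eq_zero] at h0
  exact h0

/-- **Abstract Kummer base.** `O` local with maximal ideal `(ϖ)`; `S` a Noetherian domain, integral over `O`, with an
element `x`, `xᵉ = ϖ` (`e ≥ 1`), such that every element of `S` is congruent to a scalar modulo `x`. Then every maximal
ideal of `S` contracts to `𝔪_O ∋ ϖ` (integrality), so contains `x`; `S/(x)` is a quotient of `O` by a proper ideal
containing `𝔪_O`, i.e. the residue field; hence `(x)` is the unique maximal ideal, `S` is local, and — a Noetherian local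
domain with principal maximal ideal — a principal ideal ring (Mathlib `tfae_of_isNoetherianRing_of_isLocalRing_of_isDomain`).
OURS. -/
theorem isLocalRing_and_isPrincipalIdealRing_of_pow_eq {S : Type*} [IsLocalRing O] [CommRing S] [IsDomain S]
    [IsNoetherianRing S] [Algebra O S] [Algebra.IsIntegral O S] {ϖ : O} (hmO : maximalIdeal O = Ideal.span {ϖ})
    {x : S} {e : ℕ} (he : 1 ≤ e) (hxe : x ^ e = algebraMap O S ϖ)
    (hmod : ∀ s : S, ∃ a : O, s - algebraMap O S a ∈ Ideal.span {x}) :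
    IsLocalRing S ∧ IsPrincipalIdealRing S := by
  -- every maximal ideal of `S` contains `x`
  have hxN : ∀ N : Ideal S, N.IsMaximal → x ∈ N := by
    intro N hN
    have hcomap : N.comap (algebraMap O S) = maximalIdeal O :=
      IsLocalRing.eq_maximalIdeal (Ideal.isMaximal_comap_of_isIntegral_of_isMaximal N)
    have hϖN : algebraMap O S ϖ ∈ N := by
      have : ϖ ∈ N.comap (algebraMap O S) := by rw [hcomap, hmO]; exact Ideal.mem_span_singleton_self ϖ
      exact this
    exact hN.isPrime.mem_of_pow_mem e (by rw [hxe]; exact hϖN)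
  -- so `x` is not a unit
  have hxu : ¬ IsUnit x := by
    intro hu
    obtain ⟨N, hN⟩ := Ideal.exists_maximal S
    exact hN.ne_top (Ideal.eq_top_of_isUnit_mem N (hxN N hN) hu)
  -- `S/(x)` is a quotient of `O` with kernel `𝔪_O`: the residue field
  let π : O →+* S ⧸ Ideal.span {x} := (Ideal.Quotient.mk (Ideal.span {x})).comp (algebraMap O S)
  have hπsurj : Function.Surjective π := by
    intro z
    obtain ⟨s, rfl⟩ := Ideal.Quotient.mk_surjective z
    obtain ⟨a, ha⟩ := hmod s
    exact ⟨a, (Ideal.Quotient.eq.mpr ha).symm⟩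
  have hker : RingHom.ker π = maximalIdeal O := by
    apply le_antisymm
    · intro a ha
      by_contra hna
      have hau : IsUnit a := IsLocalRing.notMem_maximalIdeal.mp hna
      rw [RingHom.mem_ker] at ha
      have ha' : algebraMap O S a ∈ Ideal.span {x} := by
        simpa only [π, RingHom.comp_apply, Ideal.Quotient.eq_zero_iff_mem] using ha
      exact hxu (isUnit_of_dvd_unit (Ideal.mem_span_singleton.mp ha') (hau.map _))
    · rw [hmO, Ideal.span_singleton_le_iff_mem, RingHom.mem_ker]
      have : algebraMap O S ϖ ∈ Ideal.span {x} := by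
        rw [← hxe]
        exact Ideal.pow_mem_of_mem _ (Ideal.mem_span_singleton_self x) e he
      simpa only [π, RingHom.comp_apply, Ideal.Quotient.eq_zero_iff_mem] using this
  have hM : (Ideal.span {x} : Ideal S).IsMaximal := by
    apply Ideal.Quotient.maximal_of_isField
    have eqv : O ⧸ maximalIdeal O ≃+* S ⧸ Ideal.span {x} :=
      (Ideal.quotEquivOfEq hker.symm).trans (RingHom.quotientKerEquivOfSurjective hπsurj)
    have hF : IsField (O ⧸ maximalIdeal O) :=
      (Ideal.Quotient.maximal_ideal_iff_isField_quotient _).mp inferInstance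
    exact MulEquiv.isField hF eqv.symm.toMulEquiv
  have huniq : ∀ N : Ideal S, N.IsMaximal → N = Ideal.span {x} := fun N hN =>
    (hM.eq_of_le hN.ne_top ((Ideal.span_singleton_le_iff_mem _).mpr (hxN N hN))).symm
  haveI hloc : IsLocalRing S := IsLocalRing.of_unique_max_ideal ⟨Ideal.span {x}, hM, huniq⟩
  refine ⟨hloc, ?_⟩
  have hmS : maximalIdeal S = Ideal.span {x} := (IsLocalRing.eq_maximalIdeal hM).symm
  have hprinc : (maximalIdeal S).IsPrincipal := ⟨⟨x, by rw [hmS]⟩⟩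
  exact ((tfae_of_isNoetherianRing_of_isLocalRing_of_isDomain S).out 4 0).mp hprinc

/-- **Card 6, step (b) (Sketch `KummerBaseIsLocalPIR`, VERBATIM).** Over a principal ideal domain `O` with a prime `ϖ`
which is moreover local (a DVR and its uniformizer), `O[X]/(Xᵉ − ϖ)` (`e ≥ 1`, Eisenstein) is again a domain, local,
and a principal ideal ring — the regular `O`-curve whose trace is the curvilinear jet `k[X]/(Xᵉ)`. Proof: domain by
Eisenstein + Gauss (`prime_X_pow_sub_C`); local and principal by `isLocalRing_and_isPrincipalIdealRing_of_pow_eq`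
(`O[X]/(Xᵉ − ϖ)` is finite, hence integral, over `O`; `x̄ᵉ = ϖ`; every class is a scalar modulo `x̄`; `(ϖ)` is the
maximal ideal of `O` since `ϖ` is irreducible in a PID). OURS. -/
theorem KummerBaseIsLocalPIR :
  ∀ (O : Type) [CommRing O] [IsPrincipalIdealRing O] (ϖ : O) (e : ℕ), IsDomain O → IsLocalRing O → Prime ϖ → 1 ≤ e →
    IsDomain (AdjoinRoot (Polynomial.X ^ e - Polynomial.C ϖ : Polynomial O)) ∧
    IsLocalRing (AdjoinRoot (Polynomial.X ^ e - Polynomial.C ϖ : Polynomial O)) ∧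
    IsPrincipalIdealRing (AdjoinRoot (Polynomial.X ^ e - Polynomial.C ϖ : Polynomial O)) := by
  intro O _ _ ϖ e hdom hloc hϖ he
  haveI := hdom
  haveI := hloc
  have hmon : (X ^ e - C ϖ : O[X]).Monic := monic_X_pow_sub_C ϖ (by omega)
  haveI hS : IsDomain (AdjoinRoot (X ^ e - C ϖ : O[X])) :=
    AdjoinRoot.isDomain_of_prime (prime_X_pow_sub_C hϖ he)
  haveI : Module.Finite O (AdjoinRoot (X ^ e - C ϖ : O[X])) := hmon.finite_adjoinRoot
  haveI : Algebra.IsIntegral O (AdjoinRoot (X ^ e - C ϖ : O[X])) := Algebra.IsIntegral.of_finite O _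
  have hϖmax : (Ideal.span {ϖ} : Ideal O).IsMaximal :=
    PrincipalIdealRing.isMaximal_of_irreducible hϖ.irreducible
  have hmO : maximalIdeal O = Ideal.span {ϖ} := (IsLocalRing.eq_maximalIdeal hϖmax).symm
  exact ⟨hS, isLocalRing_and_isPrincipalIdealRing_of_pow_eq hmO he (root_X_pow_sub_C_pow ϖ e)
    (exists_sub_algebraMap_mem_span_root _)⟩

end Kummer

end Summit.ResolutionOfSingularities.ResolutionOfSingularities.Theorems.EquisingularLift.RamifiedCoalescence
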